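import Mathlib
import HarnessLib

/-!
# Route `IsogenyRedei` — support item `SliceFrame` (stmt-Parity-14953): the `X² + 1` slice

Step (ii) of `SliceFrame`.

* `abs_sum_mul_le_of_monotone` — Abel summation in inequality form: for a nonnegative
  nondecreasing weight `φ`, `|∑_{1 ≤ n ≤ x} a(n) φ(n)| ≤ 2 φ(x) · max_{m ≤ x} |∑_{n ≤ m} a(n)|`.
* `cofactor_tail_isLittleO` — for a fixed cofactor modulus `e ≥ 1`, a bound
  `A_e(y) = ∑_{n ≤ y, e ∣ n²+1} μ((n²+1)/e) = O(y/(log y)²)` gives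
  `T_e(x) = ∑_{n ≤ x, e ∣ n²+1, (n²+1)/e > x^{1−η}} μ((n²+1)/e) log((n²+1)/e) = o(x)`
  (partial summation against the nondecreasing weight `[(n²+1)/e > x^{1−η}] log((n²+1)/e) ≤
  log(x²+1)`, and `max_{m ≤ x} |A_e(m)| ≤ y₀ + √x + 4K x/(log x)²`).
* `quadratic_slice` — the route decl `GaussianTailLargeCofactor` (verbatim hypothesis: the part
  of the `X²+1` tail with cofactor `> E(ε)` is `≤ εx`) together with `T_e = o(x)` for every `e`
  gives the whole `X²+1` slice of the Möbius-tail frame: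
  `∑_{n ≤ x} ∑_{d ∣ n²+1, d > x^{1−η}} μ(d) log d = o(x)` (the statement of
  `GaussianFractions.QuadraticMobiusTail`, stmt-Parity-13616, derived here from the two inputs):
  split each inner sum at `E·d < n²+1`, and reindex the bounded-cofactor part by `e = (n²+1)/d ≤ E`.
-/

namespace Summit.Parity.BatemanHorn.Theorems.SliceFrame

open Finset Filter Asymptotics

open scoped ArithmeticFunction.Moebius

/-! ### Abel summation, inequality form -/

/-- **Abel's identity** for sums over `[1, x]`: with `A(m) = ∑_{1 ≤ n ≤ m} a(n)`,
`∑_{1 ≤ n ≤ x} a(n) φ(n) = A(x) φ(x) − ∑_{m < x} A(m) (φ(m+1) − φ(m))`. [folklore] -/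
theorem sum_Icc_mul_eq_abel (a φ : ℕ → ℝ) (x : ℕ) :
    ∑ n ∈ Finset.Icc 1 x, a n * φ n
      = (∑ n ∈ Finset.Icc 1 x, a n) * φ x
        - ∑ m ∈ Finset.range x, (∑ n ∈ Finset.Icc 1 m, a n) * (φ (m + 1) - φ m) := by
  induction x with
  | zero => simp
  | succ x ih =>
    rw [Finset.sum_Icc_succ_top (Nat.le_add_left 1 x), Finset.sum_Icc_succ_top (Nat.le_add_left 1 x),
      Finset.sum_range_succ, ih]
    ring

/-- **Abel summation, inequality form.** If `0 ≤ φ(0)`, `φ` is nondecreasing, and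
`|∑_{1 ≤ n ≤ m} a(n)| ≤ M` for all `m ≤ x`, then `|∑_{1 ≤ n ≤ x} a(n) φ(n)| ≤ 2 M φ(x)`.
[folklore] -/
theorem abs_sum_mul_le_of_monotone (a φ : ℕ → ℝ) (x : ℕ) {M : ℝ}
    (hφ0 : 0 ≤ φ 0) (hφ : ∀ n, φ n ≤ φ (n + 1))
    (hM : ∀ m, m ≤ x → |∑ n ∈ Finset.Icc 1 m, a n| ≤ M) :
    |∑ n ∈ Finset.Icc 1 x, a n * φ n| ≤ 2 * M * φ x := by
  have hM0 : 0 ≤ M := (abs_nonneg _).trans (hM 0 (Nat.zero_le _))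
  have hφmono : Monotone φ := monotone_nat_of_le_succ hφ
  have hφnn : ∀ n, 0 ≤ φ n := fun n => hφ0.trans (hφmono (Nat.zero_le n))
  rw [sum_Icc_mul_eq_abel]
  have h1 : |(∑ n ∈ Finset.Icc 1 x, a n) * φ x| ≤ M * φ x := by
    rw [abs_mul, abs_of_nonneg (hφnn x)]
    exact mul_le_mul_of_nonneg_right (hM x le_rfl) (hφnn x)
  have h2 : |∑ m ∈ Finset.range x, (∑ n ∈ Finset.Icc 1 m, a n) * (φ (m + 1) - φ m)|
      ≤ M * (φ x - φ 0) := by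
    refine (Finset.abs_sum_le_sum_abs _ _).trans ?_
    have hpt : ∀ m ∈ Finset.range x,
        |(∑ n ∈ Finset.Icc 1 m, a n) * (φ (m + 1) - φ m)| ≤ M * (φ (m + 1) - φ m) := by
      intro m hm
      have hd : 0 ≤ φ (m + 1) - φ m := sub_nonneg.mpr (hφ m)
      rw [abs_mul, abs_of_nonneg hd]
      exact mul_le_mul_of_nonneg_right (hM m (Finset.mem_range.mp hm).le) hd
    refine (Finset.sum_le_sum hpt).trans (le_of_eq ?_)
    rw [← Finset.mul_sum, Finset.sum_range_sub]
  have h3 : M * (φ x - φ 0) ≤ M * φ x := by nlinarith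
  calc |(∑ n ∈ Finset.Icc 1 x, a n) * φ x
        - ∑ m ∈ Finset.range x, (∑ n ∈ Finset.Icc 1 m, a n) * (φ (m + 1) - φ m)|
      ≤ |(∑ n ∈ Finset.Icc 1 x, a n) * φ x|
        + |∑ m ∈ Finset.range x, (∑ n ∈ Finset.Icc 1 m, a n) * (φ (m + 1) - φ m)| :=
        abs_sub _ _
    _ ≤ M * φ x + M * φ x := add_le_add h1 (h2.trans h3)
    _ = 2 * M * φ x := by ring

/-! ### The bounded-cofactor pieces are `o(x)` -/

/-- Three growth facts along `ℕ`: `log x · y₀ = o(x)`, `log x · √x = o(x)`, `x / log x = o(x)`.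
[folklore] -/
theorem isLittleO_log_aux (y₀ K : ℝ) :
    (fun x : ℕ => 6 * Real.log x * (y₀ + Real.sqrt x) + 24 * K * ((x : ℝ) / Real.log x))
      =o[atTop] fun x : ℕ => (x : ℝ) := by
  -- `log x = o(x)` along `ℕ`
  have hlog : (fun x : ℕ => Real.log x) =o[atTop] fun x : ℕ => (x : ℝ) :=
    Real.isLittleO_log_id_atTop.comp_tendsto tendsto_natCast_atTop_atTop
  -- `log x · √x = o(x)`
  have hlogsqrt : (fun x : ℕ => Real.log x * Real.sqrt x) =o[atTop] fun x : ℕ => (x : ℝ) := by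
    have h1 : (fun x : ℝ => Real.log x) =o[atTop] fun x : ℝ => x ^ (1 / 2 : ℝ) :=
      isLittleO_log_rpow_atTop (by norm_num)
    have h2 : (fun x : ℝ => Real.sqrt x) =O[atTop] fun x : ℝ => x ^ (1 / 2 : ℝ) := by
      refine IsBigO.of_bound 1 (Eventually.of_forall fun x => ?_)
      rw [Real.sqrt_eq_rpow, one_mul]
    have h3 := (h1.mul_isBigO h2).comp_tendsto tendsto_natCast_atTop_atTop
    refine h3.congr' EventuallyEq.rfl ?_
    filter_upwards [eventually_ge_atTop 0] with x _
    simp only [Function.comp_apply]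
    rw [← Real.rpow_add' (Nat.cast_nonneg x) (by norm_num)]
    norm_num
  -- `x / log x = o(x)`
  have hdiv : (fun x : ℕ => (x : ℝ) / Real.log x) =o[atTop] fun x : ℕ => (x : ℝ) := by
    refine (isLittleO_iff_tendsto' ?_).mpr ?_
    · filter_upwards [eventually_ge_atTop 1] with x hx h0
      exact absurd h0 (by positivity)
    · have ht : Tendsto (fun x : ℕ => (Real.log x)⁻¹) atTop (nhds 0) :=
        tendsto_inv_atTop_zero.comp (Real.tendsto_log_atTop.comp tendsto_natCast_atTop_atTop)
      refine ht.congr' ?_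
      filter_upwards [eventually_ge_atTop 1] with x hx
      have hx0 : (x : ℝ) ≠ 0 := by positivity
      field_simp
  have hA := ((hlog.const_mul_left (6 * y₀)).add (hlogsqrt.const_mul_left 6)).add
    (hdiv.const_mul_left (24 * K))
  refine hA.congr' ?_ EventuallyEq.rfl
  filter_upwards with x
  ring

/-- **The bounded-cofactor pieces (step (ii) of `SliceFrame`).** For `e ≥ 1`, a bound
`|A_e(y)| ≤ K y/(log y)²` (`y ≥ y₀`) for `A_e(y) = ∑_{n ≤ y, e ∣ n²+1} μ((n²+1)/e)` gives
`T_e(x) = ∑_{n ≤ x, e ∣ n²+1, (n²+1)/e > x^{1−η}} μ((n²+1)/e)·log((n²+1)/e) = o(x)`, by partial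
summation. [folklore] -/
theorem cofactor_tail_isLittleO {e : ℕ} (η : ℝ)
    (hA : ∃ K : ℝ, ∃ y₀ : ℕ, ∀ y : ℕ, y₀ ≤ y →
      |∑ n ∈ (Finset.Icc 1 y).filter (fun n : ℕ => e ∣ n ^ 2 + 1), (μ ((n ^ 2 + 1) / e) : ℝ)|
        ≤ K * (y : ℝ) / Real.log y ^ 2) :
    (fun x : ℕ => ∑ n ∈ Finset.Icc 1 x,
        (if e ∣ n ^ 2 + 1 ∧ (x : ℝ) ^ (1 - η) < (((n ^ 2 + 1) / e : ℕ) : ℝ) then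
          (μ ((n ^ 2 + 1) / e) : ℝ) * Real.log (((n ^ 2 + 1) / e : ℕ) : ℝ) else 0))
      =o[atTop] fun x : ℕ => (x : ℝ) := by
  classical
  obtain ⟨K, y₀, hK⟩ := hA
  set K₁ : ℝ := max K 0 with hK₁
  have hK₁0 : 0 ≤ K₁ := le_max_right _ _
  -- the sequence `a` and its partial sums `A_e`
  set a : ℕ → ℝ := fun n => if e ∣ n ^ 2 + 1 then (μ ((n ^ 2 + 1) / e) : ℝ) else 0 with ha
  have hAeq : ∀ m : ℕ, ∑ n ∈ Finset.Icc 1 m, a n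
      = ∑ n ∈ (Finset.Icc 1 m).filter (fun n : ℕ => e ∣ n ^ 2 + 1), (μ ((n ^ 2 + 1) / e) : ℝ) := by
    intro m; rw [Finset.sum_filter]
  have habs_a : ∀ n, |a n| ≤ 1 := by
    intro n
    simp only [ha]
    split_ifs
    · exact_mod_cast (ArithmeticFunction.abs_moebius_le_one)
    · simp
  have htrivA : ∀ m : ℕ, |∑ n ∈ Finset.Icc 1 m, a n| ≤ m := by
    intro m
    calc |∑ n ∈ Finset.Icc 1 m, a n| ≤ ∑ n ∈ Finset.Icc 1 m, |a n| := Finset.abs_sum_le_sum_abs _ _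
      _ ≤ ∑ _n ∈ Finset.Icc 1 m, (1 : ℝ) := Finset.sum_le_sum (fun n _ => habs_a n)
      _ = m := by simp
  -- uniform bound for the partial sums up to `x`
  have hMx : ∀ x : ℕ, ∀ m : ℕ, m ≤ x →
      |∑ n ∈ Finset.Icc 1 m, a n| ≤ (y₀ : ℝ) + Real.sqrt x + 4 * K₁ * x / Real.log x ^ 2 := by
    intro x m hmx
    have hsx : 0 ≤ Real.sqrt x := Real.sqrt_nonneg _
    have h4 : 0 ≤ 4 * K₁ * x / Real.log x ^ 2 := by positivity
    by_cases hmy : m < y₀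
    · calc |∑ n ∈ Finset.Icc 1 m, a n| ≤ m := htrivA m
        _ ≤ y₀ := by exact_mod_cast hmy.le
        _ ≤ (y₀ : ℝ) + Real.sqrt x + 4 * K₁ * x / Real.log x ^ 2 := by linarith
    · push Not at hmy
      by_cases hsq : ((m : ℝ)) ^ 2 ≤ x
      · have hm : (m : ℝ) ≤ Real.sqrt x := by
          rw [← Real.sqrt_sq (Nat.cast_nonneg m)]
          exact Real.sqrt_le_sqrt hsq
        calc |∑ n ∈ Finset.Icc 1 m, a n| ≤ m := htrivA m
          _ ≤ (y₀ : ℝ) + Real.sqrt x + 4 * K₁ * x / Real.log x ^ 2 := by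
              linarith [Nat.cast_nonneg (α := ℝ) y₀]
      · push Not at hsq
        -- here `m ≥ 2`, `x ≥ 2`, `log m ≥ (log x)/2 > 0`
        have hsqN : x < m ^ 2 := by
          have : (x : ℝ) < ((m ^ 2 : ℕ) : ℝ) := by push_cast; exact hsq
          exact_mod_cast this
        have hm2 : 2 ≤ m := by
          by_contra h
          push Not at h
          interval_cases m
          · simp at hsqN
          · simp at hsqN; omega
        have hm1 : (1 : ℝ) < m := by exact_mod_cast hm2
        have hmx' : (m : ℝ) ≤ x := by exact_mod_cast hmx
        have hx1 : (1 : ℝ) < x := lt_of_lt_of_le hm1 hmx'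
        have hlogm : Real.log x ≤ 2 * Real.log m := by
          have h2 : Real.log ((m : ℝ) ^ 2) = 2 * Real.log m := by
            rw [Real.log_pow]; push_cast; ring
          rw [← h2]
          exact Real.log_le_log (by linarith) hsq.le
        have hlogx0 : 0 < Real.log x := Real.log_pos hx1
        have hlogm0 : 0 < Real.log m := Real.log_pos hm1
        have hKm := hK m hmy
        rw [← hAeq m] at hKm
        calc |∑ n ∈ Finset.Icc 1 m, a n| ≤ K * (m : ℝ) / Real.log m ^ 2 := hKm
          _ ≤ K₁ * (m : ℝ) / Real.log m ^ 2 := by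
              gcongr
              exact le_max_left _ _
          _ ≤ K₁ * (x : ℝ) / Real.log m ^ 2 := by gcongr
          _ ≤ 4 * K₁ * x / Real.log x ^ 2 := by
              rw [div_le_div_iff₀ (by positivity) (by positivity)]
              have : Real.log x ^ 2 ≤ 4 * Real.log m ^ 2 := by nlinarith
              have hKx : 0 ≤ K₁ * (x : ℝ) := by positivity
              nlinarith
          _ ≤ (y₀ : ℝ) + Real.sqrt x + 4 * K₁ * x / Real.log x ^ 2 := by
              linarith [Nat.cast_nonneg (α := ℝ) y₀]
  -- the pointwise Abel bound: `|T_e(x)| ≤ 2 (y₀ + √x + 4K₁x/(log x)²) log(x²+1)`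
  have hpt : ∀ x : ℕ, 2 ≤ x →
      |∑ n ∈ Finset.Icc 1 x,
        (if e ∣ n ^ 2 + 1 ∧ (x : ℝ) ^ (1 - η) < (((n ^ 2 + 1) / e : ℕ) : ℝ) then
          (μ ((n ^ 2 + 1) / e) : ℝ) * Real.log (((n ^ 2 + 1) / e : ℕ) : ℝ) else 0)|
      ≤ 2 * ((y₀ : ℝ) + Real.sqrt x + 4 * K₁ * x / Real.log x ^ 2) * (3 * Real.log x) := by
    intro x hx
    -- the weight
    set φ : ℕ → ℝ := fun n => if (x : ℝ) ^ (1 - η) < (((n ^ 2 + 1) / e : ℕ) : ℝ) then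
        Real.log (((n ^ 2 + 1) / e : ℕ) : ℝ) else 0 with hφ
    have hxpow : (0 : ℝ) ≤ (x : ℝ) ^ (1 - η) := Real.rpow_nonneg (Nat.cast_nonneg x) _
    have hφnn : ∀ n, 0 ≤ φ n := by
      intro n
      simp only [hφ]
      split_ifs with h
      · refine Real.log_nonneg ?_
        have h1 : (0 : ℝ) < (((n ^ 2 + 1) / e : ℕ) : ℝ) := hxpow.trans_lt h
        have h2 : 1 ≤ (n ^ 2 + 1) / e := by exact_mod_cast h1
        exact_mod_cast h2
      · exact le_rfl
    have hφmono : ∀ n, φ n ≤ φ (n + 1) := by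
      intro n
      have hq : (n ^ 2 + 1) / e ≤ ((n + 1) ^ 2 + 1) / e := by
        refine Nat.div_le_div_right ?_
        have := Nat.pow_le_pow_left (Nat.le_add_right n 1) 2
        omega
      have hqR : (((n ^ 2 + 1) / e : ℕ) : ℝ) ≤ ((((n + 1) ^ 2 + 1) / e : ℕ) : ℝ) := by
        exact_mod_cast hq
      by_cases h : (x : ℝ) ^ (1 - η) < (((n ^ 2 + 1) / e : ℕ) : ℝ)
      · have h' : (x : ℝ) ^ (1 - η) < ((((n + 1) ^ 2 + 1) / e : ℕ) : ℝ) := h.trans_le hqR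
        simp only [hφ]
        rw [if_pos h, if_pos h']
        exact Real.log_le_log (hxpow.trans_lt h) hqR
      · have : φ n = 0 := by simp only [hφ]; rw [if_neg h]
        rw [this]
        exact hφnn (n + 1)
    -- the summand is `a n * φ n`
    have hsummand : ∀ n : ℕ,
        (if e ∣ n ^ 2 + 1 ∧ (x : ℝ) ^ (1 - η) < (((n ^ 2 + 1) / e : ℕ) : ℝ) then
          (μ ((n ^ 2 + 1) / e) : ℝ) * Real.log (((n ^ 2 + 1) / e : ℕ) : ℝ) else 0)
        = a n * φ n := by
      intro n
      simp only [ha, hφ]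
      by_cases h1 : e ∣ n ^ 2 + 1
      · by_cases h2 : (x : ℝ) ^ (1 - η) < (((n ^ 2 + 1) / e : ℕ) : ℝ)
        · rw [if_pos ⟨h1, h2⟩, if_pos h1, if_pos h2]
        · rw [if_neg (fun h => h2 h.2), if_pos h1, if_neg h2, mul_zero]
      · rw [if_neg (fun h => h1 h.1), if_neg h1, zero_mul]
    simp_rw [hsummand]
    have habel := abs_sum_mul_le_of_monotone a φ x (hφnn 0) hφmono (hMx x)
    refine habel.trans ?_
    -- `φ x ≤ log (x² + 1) ≤ 3 log x`
    have hx2 : (2 : ℝ) ≤ x := by exact_mod_cast hx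
    have hφx : φ x ≤ 3 * Real.log x := by
      have hlog3 : Real.log (((x ^ 2 + 1 : ℕ)) : ℝ) ≤ 3 * Real.log x := by
        have h3 : Real.log ((x : ℝ) ^ 3) = 3 * Real.log x := by
          rw [Real.log_pow]; push_cast; ring
        rw [← h3]
        refine Real.log_le_log (by positivity) ?_
        push_cast
        nlinarith
      simp only [hφ]
      split_ifs with h
      · refine le_trans (Real.log_le_log (hxpow.trans_lt h) ?_) hlog3
        exact_mod_cast Nat.div_le_self _ _
      · linarith [Real.log_nonneg (by linarith : (1 : ℝ) ≤ x)]
    have hM0 : 0 ≤ (y₀ : ℝ) + Real.sqrt x + 4 * K₁ * x / Real.log x ^ 2 := by positivity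
    exact mul_le_mul_of_nonneg_left hφx (by positivity)
  -- conclude with the growth facts
  have hmaj := isLittleO_log_aux (y₀ : ℝ) K₁
  refine IsBigO.trans_isLittleO ?_ hmaj
  refine IsBigO.of_bound 1 ?_
  filter_upwards [eventually_ge_atTop 2] with x hx
  rw [one_mul, Real.norm_eq_abs, Real.norm_eq_abs]
  refine (hpt x hx).trans (le_trans (le_of_eq ?_) (le_abs_self _))
  have hlog0 : Real.log x ≠ 0 := (Real.log_pos (by exact_mod_cast hx)).ne'
  field_simp
  ring

/-! ### The whole `X² + 1` slice -/

/-- Reindexing the bounded-cofactor part of the inner divisor sum by the cofactor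
`e = (n²+1)/d ≤ E`. [folklore] -/
theorem inner_bounded_eq_sum_cofactor (η : ℝ) (E x n : ℕ) :
    ∑ d ∈ Nat.divisors (n ^ 2 + 1),
        (if (x : ℝ) ^ (1 - η) < (d : ℝ) ∧ ¬ E * d < n ^ 2 + 1 then
          (μ d : ℝ) * Real.log (d : ℝ) else 0)
      = ∑ e ∈ Finset.Icc 1 E,
        (if e ∣ n ^ 2 + 1 ∧ (x : ℝ) ^ (1 - η) < (((n ^ 2 + 1) / e : ℕ) : ℝ) then
          (μ ((n ^ 2 + 1) / e) : ℝ) * Real.log (((n ^ 2 + 1) / e : ℕ) : ℝ) else 0) := by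
  classical
  set N := n ^ 2 + 1 with hN
  have hN0 : N ≠ 0 := by omega
  rw [← Nat.sum_div_divisors N]
  -- restrict the divisor sum to `e ≤ E`
  have hstep : ∀ e ∈ N.divisors,
      (if (x : ℝ) ^ (1 - η) < ((N / e : ℕ) : ℝ) ∧ ¬ E * (N / e) < N then
          (μ (N / e) : ℝ) * Real.log ((N / e : ℕ) : ℝ) else 0)
        = if e ≤ E then (if (x : ℝ) ^ (1 - η) < ((N / e : ℕ) : ℝ) then
          (μ (N / e) : ℝ) * Real.log ((N / e : ℕ) : ℝ) else 0) else 0 := by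
    intro e he
    have hed : e ∣ N := Nat.dvd_of_mem_divisors he
    have hq0 : 0 < N / e := Nat.div_pos (Nat.le_of_dvd (Nat.pos_of_ne_zero hN0) hed)
      (Nat.pos_of_mem_divisors he)
    have hiff : ¬ E * (N / e) < N ↔ e ≤ E := by
      rw [not_lt]
      constructor
      · intro h
        have h' : e * (N / e) ≤ E * (N / e) := by rw [Nat.mul_div_cancel' hed]; exact h
        exact Nat.le_of_mul_le_mul_right h' hq0
      · intro h
        calc N = e * (N / e) := (Nat.mul_div_cancel' hed).symm
          _ ≤ E * (N / e) := Nat.mul_le_mul_right _ h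
    by_cases h1 : e ≤ E
    · rw [if_pos h1]
      simp only [hiff, h1, and_true]
    · rw [if_neg h1, if_neg (fun h => h1 (hiff.mp h.2))]
  rw [Finset.sum_congr rfl hstep, ← Finset.sum_filter]
  -- the divisors `e ≤ E` of `N` are the `e ∈ [1, E]` with `e ∣ N`
  have hset : N.divisors.filter (fun e => e ≤ E) = (Finset.Icc 1 E).filter (fun e => e ∣ N) := by
    ext e
    simp only [Finset.mem_filter, Nat.mem_divisors, Finset.mem_Icc]
    constructor
    · rintro ⟨⟨hd, -⟩, hle⟩
      exact ⟨⟨Nat.pos_of_dvd_of_pos hd (Nat.pos_of_ne_zero hN0), hle⟩, hd⟩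
    · rintro ⟨⟨h1, hle⟩, hd⟩
      exact ⟨⟨hd, hN0⟩, hle⟩
  rw [hset, Finset.sum_filter]
  refine Finset.sum_congr rfl (fun e _ => ?_)
  by_cases h1 : e ∣ N
  · by_cases h2 : (x : ℝ) ^ (1 - η) < ((N / e : ℕ) : ℝ)
    · rw [if_pos h1, if_pos h2, if_pos ⟨h1, h2⟩]
    · rw [if_pos h1, if_neg h2, if_neg (fun h => h2 h.2)]
  · rw [if_neg h1, if_neg (fun h => h1 h.1)]

/-- Splitting the `X²+1` tail at the cofactor `E`: the whole tail is the large-cofactor part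
plus the sum over `e ≤ E` of the pieces `T_e`. [folklore] -/
theorem tail_eq_large_add_bounded (η : ℝ) (E x : ℕ) :
    ∑ n ∈ Finset.Icc 1 x, ∑ d ∈ Nat.divisors (n ^ 2 + 1),
        (if (x : ℝ) ^ (1 - η) < ((d : ℕ) : ℝ) then (μ d : ℝ) * Real.log (d : ℝ) else 0)
      = ∑ n ∈ Finset.Icc 1 x, ∑ d ∈ Nat.divisors (n ^ 2 + 1),
          (if (x : ℝ) ^ (1 - η) < (d : ℝ) ∧ E * d < n ^ 2 + 1 then
            (μ d : ℝ) * Real.log (d : ℝ) else 0)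
        + ∑ e ∈ Finset.Icc 1 E, ∑ n ∈ Finset.Icc 1 x,
          (if e ∣ n ^ 2 + 1 ∧ (x : ℝ) ^ (1 - η) < (((n ^ 2 + 1) / e : ℕ) : ℝ) then
            (μ ((n ^ 2 + 1) / e) : ℝ) * Real.log (((n ^ 2 + 1) / e : ℕ) : ℝ) else 0) := by
  rw [Finset.sum_comm (s := Finset.Icc 1 E), ← Finset.sum_add_distrib]
  refine Finset.sum_congr rfl (fun n _ => ?_)
  rw [← inner_bounded_eq_sum_cofactor η E x n, ← Finset.sum_add_distrib]
  refine Finset.sum_congr rfl (fun d _ => ?_)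
  by_cases h1 : (x : ℝ) ^ (1 - η) < (d : ℝ)
  · by_cases h2 : E * d < n ^ 2 + 1
    · rw [if_pos h1, if_pos ⟨h1, h2⟩, if_neg (fun h => h.2 h2), add_zero]
    · rw [if_pos h1, if_neg (fun h => h2 h.2), if_pos ⟨h1, h2⟩, zero_add]
  · rw [if_neg h1, if_neg (fun h => h1 h.1), if_neg (fun h => h1 h.1), add_zero]

/-- **The `X²+1` slice (step (ii) of `SliceFrame`).** The route decl `GaussianTailLargeCofactor`
(hypothesis `hL`, verbatim) and `T_e = o(x)` for every cofactor `e ≥ 1` give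
`∑_{n ≤ x} ∑_{d ∣ n²+1, d > x^{1−η}} μ(d) log d = o(x)` for the same `η`. [folklore] -/
theorem quadratic_slice
    (hL : ∃ η : ℝ, 0 < η ∧ η < 1 ∧ ∀ ε : ℝ, 0 < ε → ∃ E : ℕ, ∀ᶠ x : ℕ in Filter.atTop,
      |∑ n ∈ Finset.Icc 1 x, ∑ d ∈ Nat.divisors (n ^ 2 + 1),
        (if (x : ℝ) ^ (1 - η) < (d : ℝ) ∧ E * d < n ^ 2 + 1 then
          (ArithmeticFunction.moebius d : ℝ) * Real.log (d : ℝ) else 0)| ≤ ε * (x : ℝ))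
    (hT : ∀ η : ℝ, ∀ e : ℕ, 1 ≤ e → (fun x : ℕ => ∑ n ∈ Finset.Icc 1 x,
        (if e ∣ n ^ 2 + 1 ∧ (x : ℝ) ^ (1 - η) < (((n ^ 2 + 1) / e : ℕ) : ℝ) then
          (μ ((n ^ 2 + 1) / e) : ℝ) * Real.log (((n ^ 2 + 1) / e : ℕ) : ℝ) else 0))
      =o[atTop] fun x : ℕ => (x : ℝ)) :
    ∃ η : ℝ, 0 < η ∧ η < 1 ∧ (fun x : ℕ => ∑ n ∈ Finset.Icc 1 x,
        ∑ d ∈ Nat.divisors (n ^ 2 + 1), if (x : ℝ) ^ (1 - η) < ((d : ℕ) : ℝ) then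
          (ArithmeticFunction.moebius d : ℝ) * Real.log (d : ℝ) else 0)
      =o[Filter.atTop] fun x : ℕ => (x : ℝ) := by
  obtain ⟨η, hη0, hη1, hLε⟩ := hL
  refine ⟨η, hη0, hη1, ?_⟩
  refine isLittleO_iff.mpr (fun c hc => ?_)
  obtain ⟨E, hE⟩ := hLε (c / 2) (half_pos hc)
  have hb : (fun x : ℕ => ∑ e ∈ Finset.Icc 1 E, ∑ n ∈ Finset.Icc 1 x,
      (if e ∣ n ^ 2 + 1 ∧ (x : ℝ) ^ (1 - η) < (((n ^ 2 + 1) / e : ℕ) : ℝ) then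
        (μ ((n ^ 2 + 1) / e) : ℝ) * Real.log (((n ^ 2 + 1) / e : ℕ) : ℝ) else 0))
      =o[atTop] fun x : ℕ => (x : ℝ) :=
    IsLittleO.sum (fun e he => hT η e (Finset.mem_Icc.mp he).1)
  filter_upwards [hE, hb.def (half_pos hc)] with x h1 h2
  rw [tail_eq_large_add_bounded η E x]
  rw [Real.norm_natCast] at h2 ⊢
  refine (norm_add_le _ _).trans ?_
  rw [Real.norm_eq_abs]
  linarith

end Summit.Parity.BatemanHorn.Theorems.SliceFrame
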